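/-
Copyright (c) 2026 the pub-hodgecm-mathlib formalisation cell (harness21).  Prover seat hodgecm-mathlib-F0P2-p10 (g4), Track B ∕ R90-TF, h413 = `stmt-HodgeConjecture-24833`,
R90-TF section S8 «ContSpec-n½», socket (E) :276, E1-PLANCHEREL BODY — ASSEMBLY of the named letter `hFub` (S8 dealer R90-CS-plan (g4) S8-R285; joint census `R90/S8/CENSUS-PlancherelBody-bricks.K2E1-p16-F0P2-p10.md` §PB-1):
THE INTERTWINED BRACKET `[Ψ₂]_β` of MW's inner-product formula II.2.1 on `U(2,1)_{L∕L⁺}`, UNFOLDED: `= 0` off the self-associate locus (★ C4a by name) and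
`= (ν𝓕)⁻¹(2π)⁻¹·K·V·∫_ℝ mellin f(−w̄)·⟪φ, M(w₀,w)φ′⟫_{K_U}·conj(mellin f′(−w)) dy` (`w = c₀ + iy`, any `c₀ > 2`) on the strict self-dual locus — ★ hFub-a∕b ∘ ★ hFub-c1 ∘ ★ hFub-c2∕c3.
-/
import Summits.HodgeConjecture.HodgeConjecture.Theorems.K2E1ChiPseudoEisensteinBracketTwoFubiniCMThree   -- ★ hFub-c1 p865512 (brings ★ hFub-b p865376, ★ hFub-c2∕c3 p865445, ★ C2, ★ C4a, ★ PB-1b)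
import Summits.HodgeConjecture.HodgeConjecture.Theorems.K2E1ChiPseudoEisensteinInnerProductCMThree     -- ★ C4b p863211: brings the constant-term invariance lemmas (★ `borelConstantTerm_unipotent_mul_three`, ★ `…_rational_borel_mul_of_rational_invariant`)
import HarnessLib

/-!
# hFub ASSEMBLY — `K2E1ChiPseudoEisensteinBracketTwoUnfoldedCMThree`: THE INTERTWINED BRACKET `[Ψ₂]_β` ON `U(2,1)`, UNFOLDED (MISSES = 0 ∕ HITS = MELLIN LINE INTEGRAL)

Track B ∕ R90-TF, crux h413 = `stmt-HodgeConjecture-24833`, route of record `HCCMUnconditional`; cell `hodgecm-mathlib`, R90-TF programme, section S8 «ContSpec-n½», socket (E)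
(B ED. 7 :276), E1-PLANCHEREL BODY.  ★ PB-1a p865168: `⟨θ_{f,φ}, θ_{f′,φ′}⟩_X = c_μ·([Ψ₁]_β + [Ψ₂]_β)`, `Ψ₂ = (f∘H)φ·conj(CT θ′ − (f′∘H)φ′)`, `θ′ = E((f′∘H)φ′)`; ★ PB-1b p865195 + p865252
settle `[Ψ₁]_β`.  THIS FILE settles `[Ψ₂]_β` — the named letter `hFub` of ★ PB-1c-1 p865336 — in the two generic cases:
* §1 `MISSES` (the reflected pair `(χ₁′ʷ, χ₂′)` misses `(χ₁, χ₂)`: `χ₂ ≠ χ₂′` or `χ₁(χ₁′ʷ)⁻¹` not a norm twist; in the same family: the pair is NOT self-associate):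
  **`β•Ψ₂ ∈ L¹(ν_G)` and `[Ψ₂]_β = 0`** — ★ C2 (`CT θ′ − (f′∘H)φ′ = (ν𝓕)⁻¹•orbital integral`) and ★ C4a `integral_weight_smul_wZero_eq_zero_cm_three` BY NAME, with ★ C4b's plumbing for the
  measurability and the `N(𝔸)`∕`B(L⁺)`-invariance of `J = CT θ′ − (f′∘H)φ′` (★ `borelConstantTerm_unipotent_mul_three`, ★ `borelConstantTerm_rational_borel_mul_of_rational_invariant`);
* §2 `HITS` (strict self-dual locus `χ₁′ʷ = χ₁`, `χ₂′ = χ₂`, `χ₁` unitary, `χ₂` automorphic, `f ∈ C_c((0,∞))`, `f′ ∈ C²_c((0,∞))`, any `c₀ > 2`): there is ONE `K ∈ (0,∞)` (★ (δ)₃) with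
  **`[Ψ₂]_β = ((ν𝓕)⁻¹·(2π)⁻¹)·∫_ℝ (K·V·(mellin f(−w̄)·⟪φ, 𝓜̃_w⟫_{K_U}))·conj(mellin f′(−w)) dy`**, `w = c₀+iy`, `V = idelicCovolume L ν_I`,
  `𝓜̃_w = (∫_N f′^{φ′}_w(w₀(v·)) dν)·H^{w−2} = M(w₀,w)φ′` — ★ hFub-b p865376 (Mellin inversion inside the orbital integral + first Fubini) ∘ ★ hFub-c1 p865512 (second Fubini) ∘
  ★ hFub-c2∕c3 p865445 (the `w`-slices).  This is the `w = w₀` term of [MoeglinWaldspurger1995] II.2.1 for `θ_{f,φ}` on `U(2,1)`, on the line `Re w = c₀ > 2` (before any contour shift).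
THEOREMS ONLY (no `def`, no `instance`, no notation, no named-fact hypothesis, no `sorry`; default heartbeats); lane `--supports stmt-HodgeConjecture-24833 --as helper` (count-neutral).
Not treated: the norm-twist-shifted self-associate case `χ₁(χ₁′ʷ)⁻¹ = ‖·‖^{it}`, `t ≠ 0` (c2′).

HONEST LABEL.  With ★ PB-1a∕PB-1b this makes MW's two-term inner-product formula for `θ_{f,φ}` on `U(2,1)` ★ LETTER-FREE off c2′; it pays nothing at the (E) socket (PB-2's
contour shift and PB-3a's Hecke action remain the socket's mathematics).  HC_CM is proved only modulo the 7 printed citations (2 remaining named inputs: hLiu418 =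
`stmt-HodgeConjecture-24832`, h413 = `stmt-HodgeConjecture-24833`) until rung 0 closes; count-neutral.
-/

set_option autoImplicit false
set_option linter.dupNamespace false  -- the mandated namespace repeats the summit's segment (`HodgeConjecture.HodgeConjecture`)

noncomputable section

open MeasureTheory Measure Set Filter Topology Complex NumberField IsDedekindDomain MulAction Function
open scoped Real NNReal ENNReal ComplexConjugate
open Literature.MeasureTheory.Group Literature.NumberTheory
open Literature.NumberTheory.Automorphic Literature.NumberTheory.Automorphic.UnitaryGroup AdelicGroupData
open Literature.NumberTheory.GaloisRepresentations (HeckeCharacter ideleGroup)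
open Literature.NumberTheory.Automorphic.Arthur2013.Leaves.TECR
open Summit.HodgeConjecture.HodgeConjecture.Cruxes.H413.K2E1BorelEisensteinU
open Summit.HodgeConjecture.HodgeConjecture.Cruxes.H413.K2E1CharacterEisensteinU2Defs
open Summit.HodgeConjecture.HodgeConjecture.Cruxes.H413.K2E1CharacterEisensteinU3PairDefs
open Summit.HodgeConjecture.HodgeConjecture.Cruxes.H413.K2E1ChiPseudoEisensteinRadialCMTwo (eisensteinSeriesU_comp_borelHeight_mul_arithmeticSubgroup_mul)
open Summit.HodgeConjecture.HodgeConjecture.Cruxes.H413.K2E1ChiPseudoEisensteinRadialCMThree (measurable_eisensteinSeriesU_comp_borelHeight_mul_cm_three borelConstantTerm_eisensteinSeriesU_comp_borelHeight_mul_cm_three)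
open Summit.HodgeConjecture.HodgeConjecture.Cruxes.H413.K2E1TruncatedEisensteinBoundedCMThree (measurable_borelConstantTerm)
open Summit.HodgeConjecture.HodgeConjecture.Cruxes.H413.K2E1ChiPseudoEisensteinWeightBracketsCMThree (integral_weight_smul_wZero_eq_zero_cm_three)
open Summit.HodgeConjecture.HodgeConjecture.Cruxes.H413.K2E1HeisenbergHaarU3 (isInvInvariant_of_isHaarMeasure_adelicUnipotent_three locallyCompactSpace_and_secondCountableTopology_adelicUnipotent)
open Summit.HodgeConjecture.HodgeConjecture.Cruxes.H413.K2E1ChiOrbitalIntegralFubiniCMThree (borelConstantTerm_sub_eq_mellin_intertwined_cm_three)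
open Summit.HodgeConjecture.HodgeConjecture.Cruxes.H413.K2E1ChiIntertwinedSliceBracketCMThree (exists_integral_weight_smul_intertwinedSlice_eq_mellin_cm_three)
open Summit.HodgeConjecture.HodgeConjecture.Cruxes.H413.K2E1ChiPseudoEisensteinBracketTwoFubiniCMThree (integral_weight_smul_conj_mellinIntertwined_eq_integral_slice_cm_three)

namespace Summit.HodgeConjecture.HodgeConjecture.Cruxes.H413.K2E1ChiPseudoEisensteinBracketTwoUnfoldedCMThree

variable (L : Type) [Field L] [NumberField L] [IsCMField L]
variable [MeasurableSpace (quasiSplit (↥(maximalRealSubfield L)) L (IsCMField.complexConj L) 3).Adelic] [BorelSpace (quasiSplit (↥(maximalRealSubfield L)) L (IsCMField.complexConj L) 3).Adelic]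
variable [MeasurableSpace (AdeleRing (𝓞 L) L)ˣ] [BorelSpace (AdeleRing (𝓞 L) L)ˣ]

/-! ## §1 `MISSES`: the intertwined bracket vanishes off the self-associate locus -/

/-- **`[Ψ₂]_β = 0` OFF THE SELF-ASSOCIATE LOCUS.**  Structural data: Haar `ν_G`, `μ_K`, `ν_I`, an idele class domain `𝓕_I`; a Haar measure `ν` on `N(𝔸_{L⁺})` with a fundamental domain `𝓕` of
`N(L⁺)` of compact closure; a covering weight `β`; pair sections `φ ∈ (χ₁,χ₂)`, `φ′ ∈ (χ₁′,χ₂′)` continuous bounded, `χ₁′` unitary, `χ₂, χ₂′` automorphic; `f, f′ ∈ C_c((0,∞))`.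
If `χ₂ ≠ χ₂′` or `χ₁·(χ₁′ʷ)⁻¹` is NOT a norm twist, then `β•Ψ₂ ∈ L¹(ν_G)` and **`∫ β•((f∘H)φ·conj(CT_{ν,𝓕} θ′ − (f′∘H)φ′)) dν_G = 0`**, `θ′ = E((f′∘H)φ′)` — ★ C2 writes
`CT θ′ − (f′∘H)φ′ = (ν𝓕)⁻¹•∫_N f′(H(w₀vg))φ′(w₀vg) dν`, and ★ C4a `integral_weight_smul_wZero_eq_zero_cm_three` (Tate's Lemma B on the reflected pair) kills the bracket.
[cite: MoeglinWaldspurger1995, II.1.7, II.2.1] [cite: Rogawski1990, §7.3 (pp. 96–98)] [cite: TateThesis1967, Thm. 4.4.1 (Lemma B)] -/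
theorem integral_weight_smul_wTwo_eq_zero_cm_three
    (νG : Measure (quasiSplit (↥(maximalRealSubfield L)) L (IsCMField.complexConj L) 3).Adelic) [νG.IsHaarMeasure] (μK : Measure ((standardMaximalCompactGL 3 L).comap (adelicVal (↥(maximalRealSubfield L)) L (IsCMField.complexConj L) 3 ((StdForm.antidiagonal 3).over L)) : Subgroup (quasiSplit (↥(maximalRealSubfield L)) L (IsCMField.complexConj L) 3).Adelic)) [μK.IsHaarMeasure] (νI : Measure (AdeleRing (𝓞 L) L)ˣ) [νI.IsHaarMeasure]
    {𝓕I : Set (AdeleRing (𝓞 L) L)ˣ} (h𝓕I : IsIdeleClassDomain L 𝓕I)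
    (ν : Measure ↥(adelicUnipotent (↥(maximalRealSubfield L)) L (IsCMField.complexConj L) 3)) [ν.IsHaarMeasure] {𝓕 : Set ↥(adelicUnipotent (↥(maximalRealSubfield L)) L (IsCMField.complexConj L) 3)}
    (h𝓕N : IsFundamentalDomain ↥(rationalUnipotent (↥(maximalRealSubfield L)) L (IsCMField.complexConj L) 3) 𝓕 ν) (h𝓕c : IsCompact (closure 𝓕))
    {β : (quasiSplit (↥(maximalRealSubfield L)) L (IsCMField.complexConj L) 3).Adelic → ℝ≥0∞} (hβ : IsCoveringWeight ((arithmeticBorel (↥(maximalRealSubfield L)) L (IsCMField.complexConj L) 3).map (quasiSplit (↥(maximalRealSubfield L)) L (IsCMField.complexConj L) 3).arithmeticSubgroup.subtype) β)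
    {χ₁ χ₁' : HeckeCharacter L} {χ₂ χ₂' : ↥(TorusDict.torus (IsCMField.complexConj L)) →ₜ* ℂˣ} {φ φ' : (quasiSplit (↥(maximalRealSubfield L)) L (IsCMField.complexConj L) 3).Adelic → ℂ}
    (hχ₁'u : χ₁'.IsUnitary) (hχ₂ : TorusDict.IsAutomorphic (IsCMField.complexConj L) χ₂) (hχ₂' : TorusDict.IsAutomorphic (IsCMField.complexConj L) χ₂')
    (hna : χ₂ ≠ χ₂' ∨ ¬ (χ₁ * (reflectChar (IsCMField.complexConj L) χ₁')⁻¹).IsNormTwist)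
    (hφ : IsChiSectionPair χ₁ χ₂ φ) (hφc : Continuous φ) {Cφ : ℝ} (hφC : ∀ x, ‖φ x‖ ≤ Cφ)
    (hφ' : IsChiSectionPair χ₁' χ₂' φ') (hφ'c : Continuous φ') {Cφ' : ℝ} (hφ'C : ∀ x, ‖φ' x‖ ≤ Cφ')
    {f f' : ℝ → ℂ} (hf : Continuous f) (hfs : HasCompactSupport f) (hf0 : tsupport f ⊆ Ioi 0)
    (hf' : Continuous f') (hf's : HasCompactSupport f') (hf'0 : tsupport f' ⊆ Ioi 0) :
    Integrable (fun g : (quasiSplit (↥(maximalRealSubfield L)) L (IsCMField.complexConj L) 3).Adelic => (β g).toReal • (f (borelHeight g : ℝ) * φ g * conj (borelConstantTerm ν 𝓕 (eisensteinSeriesU (fun g : (quasiSplit (↥(maximalRealSubfield L)) L (IsCMField.complexConj L) 3).Adelic => f' (borelHeight g : ℝ) * φ' g)) g - f' (borelHeight g : ℝ) * φ' g))) νG ∧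
      ∫ g : (quasiSplit (↥(maximalRealSubfield L)) L (IsCMField.complexConj L) 3).Adelic, (β g).toReal • (f (borelHeight g : ℝ) * φ g * conj (borelConstantTerm ν 𝓕 (eisensteinSeriesU (fun g : (quasiSplit (↥(maximalRealSubfield L)) L (IsCMField.complexConj L) 3).Adelic => f' (borelHeight g : ℝ) * φ' g)) g - f' (borelHeight g : ℝ) * φ' g)) ∂νG = 0 := by
  haveI := t2Space_adeleRing_of_numberField L
  haveI := locallyCompactSpace_adeleRing' L
  have hc : IsCMField.complexConj L * IsCMField.complexConj L = 1 := AlgEquiv.ext fun x => IsCMField.complexConj_apply_apply L x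
  haveI : ν.IsInvInvariant := isInvInvariant_of_isHaarMeasure_adelicUnipotent_three hc ν
  obtain ⟨hN1, hN2⟩ := locallyCompactSpace_and_secondCountableTopology_adelicUnipotent (F := ↥(maximalRealSubfield L)) (E := L) (c := IsCMField.complexConj L) (N := 3)
  haveI := hN1
  haveI := hN2
  haveI : SigmaFinite ν := inferInstance
  have hHc : Continuous fun g : (quasiSplit (↥(maximalRealSubfield L)) L (IsCMField.complexConj L) 3).Adelic => (borelHeight g : ℝ) := NNReal.continuous_coe.comp continuous_borelHeight
  -- `θ′`, `CT = θ′_B`, `J = CT − (f′∘H)φ′`: Borel, left-`N(𝔸)`∕`B(L⁺)`-invariant; `J = (ν𝓕)⁻¹ • orbital` (★ C2)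
  set θ' : (quasiSplit (↥(maximalRealSubfield L)) L (IsCMField.complexConj L) 3).Adelic → ℂ := eisensteinSeriesU (fun g : (quasiSplit (↥(maximalRealSubfield L)) L (IsCMField.complexConj L) 3).Adelic => f' (borelHeight g : ℝ) * φ' g) with hθ'
  have hθ'm : Measurable θ' := measurable_eisensteinSeriesU_comp_borelHeight_mul_cm_three L hf' hf's hf'0 hφ'c hφ'C
  have hθ'G : ∀ (γ : (quasiSplit (↥(maximalRealSubfield L)) L (IsCMField.complexConj L) 3).arithmeticSubgroup) (x : (quasiSplit (↥(maximalRealSubfield L)) L (IsCMField.complexConj L) 3).Adelic), θ' ((γ : (quasiSplit (↥(maximalRealSubfield L)) L (IsCMField.complexConj L) 3).Adelic) * x) = θ' x :=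
    eisensteinSeriesU_comp_borelHeight_mul_arithmeticSubgroup_mul f' (hφ'.toAdelic_mul hχ₂')
  have hCTm : Measurable (borelConstantTerm ν 𝓕 θ') := measurable_borelConstantTerm ν 𝓕 hθ'm
  have hCTN : ∀ u : (quasiSplit (↥(maximalRealSubfield L)) L (IsCMField.complexConj L) 3).Adelic, u ∈ adelicUnipotent (↥(maximalRealSubfield L)) L (IsCMField.complexConj L) 3 → ∀ y, borelConstantTerm ν 𝓕 θ' (u * y) = borelConstantTerm ν 𝓕 θ' y := fun u hu y =>
    borelConstantTerm_unipotent_mul_three hc ν h𝓕N (fun u' hu' x => hθ'G ⟨(u' : (quasiSplit (↥(maximalRealSubfield L)) L (IsCMField.complexConj L) 3).Adelic), hu'⟩ x) ⟨u, hu⟩ y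
  have hCTB : ∀ b ∈ arithmeticBorel (↥(maximalRealSubfield L)) L (IsCMField.complexConj L) 3, ∀ y : (quasiSplit (↥(maximalRealSubfield L)) L (IsCMField.complexConj L) 3).Adelic, borelConstantTerm ν 𝓕 θ' ((b : (quasiSplit (↥(maximalRealSubfield L)) L (IsCMField.complexConj L) 3).Adelic) * y) = borelConstantTerm ν 𝓕 θ' y := fun b hb y =>
    borelConstantTerm_rational_borel_mul_of_rational_invariant ν h𝓕N hθ'G b hb y
  have hφ'B := (K2E1BorelCosetsDictionary.forall_arithmeticBorel_iff (ψ := φ')).2 (hφ'.toAdelic_mul hχ₂')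
  have hJm : Measurable fun g : (quasiSplit (↥(maximalRealSubfield L)) L (IsCMField.complexConj L) 3).Adelic => borelConstantTerm ν 𝓕 θ' g - f' (borelHeight g : ℝ) * φ' g := hCTm.sub (((hf'.comp hHc).measurable).mul hφ'c.measurable)
  have hJN : ∀ (n : ↥(unipotentInBorel (↥(maximalRealSubfield L)) L (IsCMField.complexConj L) 3)) (y : (quasiSplit (↥(maximalRealSubfield L)) L (IsCMField.complexConj L) 3).Adelic),
      (fun g : (quasiSplit (↥(maximalRealSubfield L)) L (IsCMField.complexConj L) 3).Adelic => borelConstantTerm ν 𝓕 θ' g - f' (borelHeight g : ℝ) * φ' g) (((n : borelAdelic (↥(maximalRealSubfield L)) L (IsCMField.complexConj L) 3) : (quasiSplit (↥(maximalRealSubfield L)) L (IsCMField.complexConj L) 3).Adelic) * y) =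
        (fun g : (quasiSplit (↥(maximalRealSubfield L)) L (IsCMField.complexConj L) 3).Adelic => borelConstantTerm ν 𝓕 θ' g - f' (borelHeight g : ℝ) * φ' g) y := fun n y => by
    have hn := (mem_unipotentInBorel_iff _).1 n.2
    simp only [borelHeight_unipotent_mul hn, hφ'.unipotent_mul ⟨_, hn⟩ y, hCTN _ hn y]
  have hJB : ∀ b ∈ arithmeticBorel (↥(maximalRealSubfield L)) L (IsCMField.complexConj L) 3, ∀ y : (quasiSplit (↥(maximalRealSubfield L)) L (IsCMField.complexConj L) 3).Adelic,
      (fun g : (quasiSplit (↥(maximalRealSubfield L)) L (IsCMField.complexConj L) 3).Adelic => borelConstantTerm ν 𝓕 θ' g - f' (borelHeight g : ℝ) * φ' g) ((b : (quasiSplit (↥(maximalRealSubfield L)) L (IsCMField.complexConj L) 3).Adelic) * y) =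
        (fun g : (quasiSplit (↥(maximalRealSubfield L)) L (IsCMField.complexConj L) 3).Adelic => borelConstantTerm ν 𝓕 θ' g - f' (borelHeight g : ℝ) * φ' g) y := fun b hb y => by
    simp only [K2E1TruncatedEisensteinExplicit.borelHeight_arithmeticBorel_mul hb, hφ'B b hb y, hCTB b hb y]
  have hJ : ∀ g : (quasiSplit (↥(maximalRealSubfield L)) L (IsCMField.complexConj L) 3).Adelic, (fun g : (quasiSplit (↥(maximalRealSubfield L)) L (IsCMField.complexConj L) 3).Adelic => borelConstantTerm ν 𝓕 θ' g - f' (borelHeight g : ℝ) * φ' g) g =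
      ((ν 𝓕).toReal⁻¹ : ℝ) • ∫ v : ↥(adelicUnipotent (↥(maximalRealSubfield L)) L (IsCMField.complexConj L) 3), f' (borelHeight ((quasiSplit (↥(maximalRealSubfield L)) L (IsCMField.complexConj L) 3).toAdelic (weylLongU ((IsCMField.complexConj L : L ≃ₐ[↥(maximalRealSubfield L)] L) : L →+* L) (rfl : (StdForm.antidiagonal 3).over L = (StdForm.antidiagonal 3).over L)) * (v : (quasiSplit (↥(maximalRealSubfield L)) L (IsCMField.complexConj L) 3).Adelic) * g) : ℝ) * φ' ((quasiSplit (↥(maximalRealSubfield L)) L (IsCMField.complexConj L) 3).toAdelic (weylLongU ((IsCMField.complexConj L : L ≃ₐ[↥(maximalRealSubfield L)] L) : L →+* L) (rfl : (StdForm.antidiagonal 3).over L = (StdForm.antidiagonal 3).over L)) * (v : (quasiSplit (↥(maximalRealSubfield L)) L (IsCMField.complexConj L) 3).Adelic) * g) ∂ν := fun g => by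
    simp only [hθ']
    rw [borelConstantTerm_eisensteinSeriesU_comp_borelHeight_mul_cm_three L ν h𝓕N h𝓕c hf' hf's hf'0 hφ'c hφ'C hφ'.unipotent_mul (hφ'.toAdelic_mul hχ₂') g, add_sub_cancel_left]
  exact integral_weight_smul_wZero_eq_zero_cm_three L νG μK νI h𝓕I ν h𝓕N h𝓕c hβ hχ₁'u hχ₂ hχ₂' hna hφ hφc hφC hφ' hφ'c hφ'C hf hfs hf0 hf' hf's hf'0
    ((ν 𝓕).toReal⁻¹) hJm hJN hJB hJ

/-! ## §2 `HITS`: the intertwined bracket on the strict self-dual locus as a Mellin line integral -/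

/-- **`[Ψ₂]_β` ON THE STRICT SELF-DUAL LOCUS — THE `w = w₀` TERM OF MW II.2.1 FOR `U(2,1)`.**  Structural data as in §1 (and any Borel structure on `𝔸_L`, carried by ★ hFub-b).  There is
ONE `K ∈ (0,∞)` (★ (δ)₃) such that for every covering weight `β`, UNITARY `χ₁`, AUTOMORPHIC `χ₂`, Hecke character `χ₁′` with `χ₁′ʷ := reflectChar c χ₁′ = χ₁`, continuous bounded pair
sections `φ ∈ (χ₁,χ₂)`, `φ′ ∈ (χ₁′,χ₂)`, `f ∈ C_c((0,∞))`, `f′ ∈ C²_c((0,∞))` and every `c₀ > 2` (`w = c₀ + iy`, `V = idelicCovolume L ν_I`):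
**`∫ β•((f∘H)φ·conj(CT_{ν,𝓕} θ′ − (f′∘H)φ′)) dν_G = ((ν𝓕)⁻¹·(2π)⁻¹)·∫_ℝ (K·V·(mellin f(−w̄)·⟪φ, 𝓜̃_w⟫_{K_U}))·conj(mellin f′(−w)) dy`**,
`⟪φ,𝓜̃_w⟫_{K_U} = ∫_{K_U} φ(k)·conj((∫_N f′^{φ′}_w(w₀(vk)) dν)·H(k)^{w−2}) dμ_K` — ★ hFub-b p865376 pointwise in `g`, ★ hFub-c1 p865512 (the swap), ★ hFub-c2∕c3 p865445 slice by slice.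
[cite: MoeglinWaldspurger1995, II.1.7, II.2.1] [cite: Rogawski1990, §7.3 (pp. 96–98)] [cite: TateThesis1967, §4.3] [cite: Titchmarsh1948, Thm 71–72] -/
theorem exists_integral_weight_smul_wTwo_eq_mellin_cm_three [MeasurableSpace (AdeleRing (𝓞 L) L)] [BorelSpace (AdeleRing (𝓞 L) L)]
    (νG : Measure (quasiSplit (↥(maximalRealSubfield L)) L (IsCMField.complexConj L) 3).Adelic) [νG.IsHaarMeasure] (μK : Measure ((standardMaximalCompactGL 3 L).comap (adelicVal (↥(maximalRealSubfield L)) L (IsCMField.complexConj L) 3 ((StdForm.antidiagonal 3).over L)) : Subgroup (quasiSplit (↥(maximalRealSubfield L)) L (IsCMField.complexConj L) 3).Adelic)) [μK.IsHaarMeasure] (νI : Measure (AdeleRing (𝓞 L) L)ˣ) [νI.IsHaarMeasure]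
    {𝓕I : Set (AdeleRing (𝓞 L) L)ˣ} (h𝓕I : IsIdeleClassDomain L 𝓕I)
    (ν : Measure ↥(adelicUnipotent (↥(maximalRealSubfield L)) L (IsCMField.complexConj L) 3)) [ν.IsHaarMeasure] {𝓕 : Set ↥(adelicUnipotent (↥(maximalRealSubfield L)) L (IsCMField.complexConj L) 3)}
    (h𝓕N : IsFundamentalDomain ↥(rationalUnipotent (↥(maximalRealSubfield L)) L (IsCMField.complexConj L) 3) 𝓕 ν) (h𝓕c : IsCompact (closure 𝓕)) :
    ∃ K : ℝ≥0∞, K ≠ 0 ∧ K ≠ ∞ ∧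
      ∀ {β : (quasiSplit (↥(maximalRealSubfield L)) L (IsCMField.complexConj L) 3).Adelic → ℝ≥0∞}, IsCoveringWeight ((arithmeticBorel (↥(maximalRealSubfield L)) L (IsCMField.complexConj L) 3).map (quasiSplit (↥(maximalRealSubfield L)) L (IsCMField.complexConj L) 3).arithmeticSubgroup.subtype) β →
      ∀ {χ₁ χ₁' : HeckeCharacter L} {χ₂ : ↥(TorusDict.torus (IsCMField.complexConj L)) →ₜ* ℂˣ} {φ φ' : (quasiSplit (↥(maximalRealSubfield L)) L (IsCMField.complexConj L) 3).Adelic → ℂ},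
        χ₁.IsUnitary → TorusDict.IsAutomorphic (IsCMField.complexConj L) χ₂ → reflectChar (IsCMField.complexConj L) χ₁' = χ₁ →
        IsChiSectionPair χ₁ χ₂ φ → Continuous φ → ∀ {Cφ : ℝ}, (∀ x, ‖φ x‖ ≤ Cφ) →
        IsChiSectionPair χ₁' χ₂ φ' → Continuous φ' → ∀ {Cφ' : ℝ}, (∀ x, ‖φ' x‖ ≤ Cφ') →
      ∀ {f f' : ℝ → ℂ}, Continuous f → HasCompactSupport f → tsupport f ⊆ Ioi 0 → ContDiff ℝ 2 f' → HasCompactSupport f' → tsupport f' ⊆ Ioi 0 →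
      ∀ {c₀ : ℝ}, 2 < c₀ →
        ∫ g : (quasiSplit (↥(maximalRealSubfield L)) L (IsCMField.complexConj L) 3).Adelic, (β g).toReal • (f (borelHeight g : ℝ) * φ g * conj (borelConstantTerm ν 𝓕 (eisensteinSeriesU (fun g : (quasiSplit (↥(maximalRealSubfield L)) L (IsCMField.complexConj L) 3).Adelic => f' (borelHeight g : ℝ) * φ' g)) g - f' (borelHeight g : ℝ) * φ' g)) ∂νG =
          ((((ν 𝓕).toReal⁻¹ : ℝ) : ℂ) * (((2 * π)⁻¹ : ℝ) : ℂ)) *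
            ∫ y : ℝ, ((K.toReal : ℂ) * ((idelicCovolume L νI).toReal : ℂ) * (mellin f (-conj ((c₀ : ℂ) + y * I)) * ∫ k : ((standardMaximalCompactGL 3 L).comap (adelicVal (↥(maximalRealSubfield L)) L (IsCMField.complexConj L) 3 ((StdForm.antidiagonal 3).over L)) : Subgroup (quasiSplit (↥(maximalRealSubfield L)) L (IsCMField.complexConj L) 3).Adelic), φ (k : (quasiSplit (↥(maximalRealSubfield L)) L (IsCMField.complexConj L) 3).Adelic) * conj ((∫ v : ↥(adelicUnipotent (↥(maximalRealSubfield L)) L (IsCMField.complexConj L) 3), flatSectionU φ' ((c₀ : ℂ) + y * I) ((quasiSplit (↥(maximalRealSubfield L)) L (IsCMField.complexConj L) 3).toAdelic (weylLongU ((IsCMField.complexConj L : L ≃ₐ[↥(maximalRealSubfield L)] L) : L →+* L) (rfl : (StdForm.antidiagonal 3).over L = (StdForm.antidiagonal 3).over L)) * ((v : (quasiSplit (↥(maximalRealSubfield L)) L (IsCMField.complexConj L) 3).Adelic) * (k : (quasiSplit (↥(maximalRealSubfield L)) L (IsCMField.complexConj L) 3).Adelic))) ∂ν) * (((borelHeight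 (k : (quasiSplit (↥(maximalRealSubfield L)) L (IsCMField.complexConj L) 3).Adelic) : ℝ) : ℂ) ^ (((c₀ : ℂ) + y * I) - 2))) ∂μK)) * conj (mellin f' (-((c₀ : ℂ) + y * I))) := by
  obtain ⟨K, hK0, hKt, hS⟩ := exists_integral_weight_smul_intertwinedSlice_eq_mellin_cm_three L νG μK νI h𝓕I ν h𝓕N h𝓕c
  refine ⟨K, hK0, hKt, ?_⟩
  intro β hβ χ₁ χ₁' χ₂ φ φ' hχ₁u hχ₂ hw₀ hφ hφc Cφ hφC hφ' hφ'c Cφ' hφ'C f f' hf hfs hf0 hf' hf's hf'0 c₀ hc₀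
  -- (a)+(b): Mellin inversion inside the orbital integral and the first Fubini (★ hFub-b), pointwise in `g`
  have hCT : ∀ g : (quasiSplit (↥(maximalRealSubfield L)) L (IsCMField.complexConj L) 3).Adelic, borelConstantTerm ν 𝓕 (eisensteinSeriesU (fun g : (quasiSplit (↥(maximalRealSubfield L)) L (IsCMField.complexConj L) 3).Adelic => f' (borelHeight g : ℝ) * φ' g)) g - f' (borelHeight g : ℝ) * φ' g =
      ((ν 𝓕).toReal⁻¹ : ℝ) • ((((2 * π)⁻¹ : ℝ) : ℂ) * ∫ y : ℝ, mellin f' (-((c₀ : ℂ) + y * I)) * ∫ v : ↥(adelicUnipotent (↥(maximalRealSubfield L)) L (IsCMField.complexConj L) 3), flatSectionU φ' ((c₀ : ℂ) + y * I) ((quasiSplit (↥(maximalRealSubfield L)) L (IsCMField.complexConj L) 3).toAdelic (weylLongU ((IsCMField.complexConj L : L ≃ₐ[↥(maximalRealSubfield L)] L) : L →+* L) (rfl : (StdForm.antidiagonal 3).over L = (StdForm.antidiagonal 3).over L)) * (v : (quasiSplit (↥(maximalRealSubfield L)) L (IsCMField.complexConj L) 3).Adelic) * g) ∂ν) := fun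 g =>
    borelConstantTerm_sub_eq_mellin_intertwined_cm_three L ν h𝓕N h𝓕c hf' hf's hf'0 hφ'c hφ'C hφ'.unipotent_mul (hφ'.toAdelic_mul hχ₂) hc₀ g
  simp_rw [hCT]
  -- (c1): the second Fubini
  rw [integral_weight_smul_conj_mellinIntertwined_eq_integral_slice_cm_three L νG μK νI h𝓕I ν h𝓕N h𝓕c hβ hφc hφC hφ'c hφ'C hf hfs hf0 hf' hf's hf'0 hc₀]
  -- (c2∕c3): the slices
  congr 1
  refine integral_congr_ae (Eventually.of_forall fun y => ?_)
  have hre : 2 < (((c₀ : ℂ) + y * I)).re := by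
    simp only [add_re, ofReal_re, mul_re, I_re, mul_zero, ofReal_im, I_im, mul_one, sub_self, add_zero]
    exact hc₀
  dsimp only
  rw [(hS hβ hχ₁u hχ₂ hw₀ hφ hφc hφC hφ' hφ'c hφ'C hf hfs hf0 hre).2]

end Summit.HodgeConjecture.HodgeConjecture.Cruxes.H413.K2E1ChiPseudoEisensteinBracketTwoUnfoldedCMThree

end
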